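import Mathlib.Data.Finset.Card
import Mathlib.Data.Fintype.Basic
import Mathlib.Tactic.FinCases
import HarnessLib

/-!
# Combinatorial classification of the soft contact map — part 1: local rules
# (route `HullExactificationCascade`, crux `ZeroDefectDensity`, stmt-AtomisticToContinuum-12086; line `birth`,
# stub `stub_combClassification`)

The stub `stub_combClassification` classifies the following finite structures on `Fin 12`: a
symmetric irreflexive `4`-regular adjacency `A : Fin 12 → Fin 12 → Bool` and a rotation
`σ : Fin 12 → Fin 12 → Fin 12` (`σ v` is a single `4`-cycle on the neighbours of `v`) such that
every vertex has exactly two SMALL corners (`a`, `σ v a` adjacent), small corners close into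
coherently oriented triangles and large corners into quadrilaterals.  The classification (the
structure is the cuboctahedron = FCC contact graph or the anticuboctahedron = HCP contact graph)
is a finite propagation argument: grow the map from a root vertex, every new vertex being forced
by the triangle / quadrilateral clauses, and branch only on three corner types.  This file proves
the LOCAL RULES that each propagation step invokes (one lemma per rule, hypotheses = only the
clauses the rule consumes), so that the case files (`…CombCaseA/B/C/D.lean`, machine-written
straight-line proofs, every line one rule) are checked by the kernel with no search:

* bookkeeping: `asy`, `nsy`, `ne_of_adj`, `ne_of_tf`, `tf`;
* the rotation: `sg_adj`, `sg_ne`, `sg2_ne`, `sg4`, `sg_fun`, `sg_inj`, `sg_inj_ne`, `ne_of_sg`;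
* faces: `tri1`, `tri2` (small corner ⇒ triangle), `quad` (large corner ⇒ quadrilateral, with the
  derived non-adjacency of the diagonal `A v w = false`);
* degree four: `rot_cases` (a neighbour of `v` is one of the four rotation entries), `rot_nadj`;
* two small corners: `cTT12`, `cTT13` (two small corners known ⇒ the other two are large),
  `cFF12`, `cFF13` (two large known ⇒ the other two small).

Mathlib only; no named fact is used.
-/

namespace Summit.AtomisticToContinuum.Crystallization.Theorems.ZeroDefectDensityBirth.Comb

variable {A : Fin 12 → Fin 12 → Bool} {σ : Fin 12 → Fin 12 → Fin 12}

/-! ## Bookkeeping -/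

/-- Symmetry of adjacency, `true` form. [folklore] -/
theorem asy (hsym : ∀ i j : Fin 12, A i j = A j i) {x y : Fin 12} (h : A x y = true) :
    A y x = true := by
  rw [hsym]; exact h

/-- Symmetry of adjacency, `false` form. [folklore] -/
theorem nsy (hsym : ∀ i j : Fin 12, A i j = A j i) {x y : Fin 12} (h : A x y = false) :
    A y x = false := by
  rw [hsym]; exact h

/-- Adjacent vertices are distinct. [folklore] -/
theorem ne_of_adj (hirr : ∀ i : Fin 12, A i i = false) {x y : Fin 12} (h : A x y = true) :
    x ≠ y := by
  rintro rfl
  rw [hirr] at h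
  exact Bool.false_ne_true h

/-- Vertices distinguished by a third vertex are distinct. [folklore] -/
theorem ne_of_tf {x y z : Fin 12} (h1 : A x z = true) (h2 : A y z = false) : x ≠ y := by
  rintro rfl
  rw [h1] at h2
  exact Bool.noConfusion h2

/-- `true ≠ false`. [folklore] -/
theorem tf {x y : Fin 12} (h1 : A x y = true) (h2 : A x y = false) : False := by
  rw [h1] at h2
  exact Bool.noConfusion h2

/-! ## The rotation -/

/-- The successor of a neighbour is a neighbour. [folklore] -/
theorem sg_adj (hnx : ∀ v a : Fin 12, A v a = true → (A v (σ v a) = true ∧ σ v a ≠ a))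
    {v a b : Fin 12} (h : A v a = true) (s : σ v a = b) : A v b = true :=
  s ▸ (hnx v a h).1

/-- The successor of a neighbour is another neighbour. [folklore] -/
theorem sg_ne (hnx : ∀ v a : Fin 12, A v a = true → (A v (σ v a) = true ∧ σ v a ≠ a))
    {v a b : Fin 12} (h : A v a = true) (s : σ v a = b) : b ≠ a :=
  s ▸ (hnx v a h).2

/-- The rotation has no `2`-cycle. [folklore] -/
theorem sg2_ne (hcyc : ∀ v a : Fin 12, A v a = true → (σ v (σ v a) ≠ a ∧ σ v (σ v (σ v (σ v a))) = a))
    {v a b c : Fin 12} (h : A v a = true) (s1 : σ v a = b) (s2 : σ v b = c) : c ≠ a := by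
  subst s1; subst s2
  exact (hcyc v a h).1

/-- The rotation is a `4`-cycle: the fourth successor is the start. [folklore] -/
theorem sg4 (hcyc : ∀ v a : Fin 12, A v a = true → (σ v (σ v a) ≠ a ∧ σ v (σ v (σ v (σ v a))) = a))
    {v a b c d : Fin 12} (h : A v a = true) (s1 : σ v a = b) (s2 : σ v b = c) (s3 : σ v c = d) :
    σ v d = a := by
  subst s1; subst s2; subst s3
  exact (hcyc v a h).2

/-- `σ v` is a function. [folklore] -/
theorem sg_fun {v a b b' : Fin 12} (s : σ v a = b) (s' : σ v a = b') : b = b' :=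
  s.symm.trans s'

/-- `σ v` is injective on the neighbours of `v`. [folklore] -/
theorem sg_inj (hinj : ∀ v a b : Fin 12, A v a = true → A v b = true → σ v a = σ v b → a = b)
    {v a a' b : Fin 12} (h : A v a = true) (h' : A v a' = true) (s : σ v a = b) (s' : σ v a' = b) :
    a = a' :=
  hinj v a a' h h' (s.trans s'.symm)

/-- Injectivity, contrapositive. [folklore] -/
theorem sg_inj_ne (hinj : ∀ v a b : Fin 12, A v a = true → A v b = true → σ v a = σ v b → a = b)
    {v a a' b b' : Fin 12} (h : A v a = true) (h' : A v a' = true) (s : σ v a = b)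
    (s' : σ v a' = b') (n : a ≠ a') : b ≠ b' :=
  fun e => n (hinj v a a' h h' (by rw [s, s', e]))

/-- Distinct images have distinct arguments. [folklore] -/
theorem ne_of_sg {v a a' b b' : Fin 12} (s : σ v a = b) (s' : σ v a' = b') (n : b ≠ b') :
    a ≠ a' :=
  fun e => n (by rw [← s, ← s', e])

/-! ## Faces -/

/-- A small corner closes into a triangle: the rotation at the second vertex. [folklore] -/
theorem tri1 (htri : ∀ v a : Fin 12, A v a = true → A a (σ v a) = true → (σ a (σ v a) = v ∧ σ (σ v a) v = a))
    {v a b : Fin 12} (h : A v a = true) (s : σ v a = b) (t : A a b = true) : σ a b = v := by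
  subst s
  exact (htri v a h t).1

/-- A small corner closes into a triangle: the rotation at the third vertex. [folklore] -/
theorem tri2 (htri : ∀ v a : Fin 12, A v a = true → A a (σ v a) = true → (σ a (σ v a) = v ∧ σ (σ v a) v = a))
    {v a b : Fin 12} (h : A v a = true) (s : σ v a = b) (t : A a b = true) : σ b v = a := by
  subst s
  exact (htri v a h t).2

/-- A large corner closes into a quadrilateral `v, a, w, b` with consistent rotations, and the
diagonal `v w` is not an edge (else the corner `(w, v)` at `a` would be a small corner closing
into the triangle `a w v`, forcing `σ v a = w = b` and `A b b = true`). [folklore] -/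
theorem quad (hirr : ∀ i : Fin 12, A i i = false) (hsym : ∀ i j : Fin 12, A i j = A j i)
    (htri : ∀ v a : Fin 12, A v a = true → A a (σ v a) = true → (σ a (σ v a) = v ∧ σ (σ v a) v = a))
    (hquad : ∀ v a : Fin 12, A v a = true → A a (σ v a) = false → ∃ w : Fin 12,
      A a w = true ∧ σ a w = v ∧ A w (σ v a) = true ∧ σ (σ v a) v = w ∧ σ w (σ v a) = a)
    {v a b : Fin 12} (h : A v a = true) (s : σ v a = b) (f : A a b = false) :
    ∃ w : Fin 12, A a w = true ∧ σ a w = v ∧ A w b = true ∧ σ b v = w ∧ σ w b = a ∧ A v w = false := by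
  subst s
  obtain ⟨w, h1, h2, h3, h4, h5⟩ := hquad v a h f
  refine ⟨w, h1, h2, h3, h4, h5, ?_⟩
  cases hvw : A v w
  · rfl
  · exfalso
    have hwv : A w (σ a w) = true := by rw [h2]; exact asy hsym hvw
    have key := (htri a w h1 hwv).2
    rw [h2] at key
    rw [key, hirr] at h3
    exact Bool.false_ne_true h3

/-! ## Degree four -/

/-- The four rotation entries `a, σ a, σ² a, σ³ a` exhaust the neighbours of `v` (they are four
distinct neighbours and the degree is four). [folklore] -/
theorem rot_cases (hdeg : ∀ i : Fin 12, (Finset.univ.filter (fun j : Fin 12 => A i j = true)).card = 4)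
    (hnx : ∀ v a : Fin 12, A v a = true → (A v (σ v a) = true ∧ σ v a ≠ a))
    (hcyc : ∀ v a : Fin 12, A v a = true → (σ v (σ v a) ≠ a ∧ σ v (σ v (σ v (σ v a))) = a))
    {v a b c d x : Fin 12} (h : A v a = true) (s1 : σ v a = b) (s2 : σ v b = c) (s3 : σ v c = d)
    (hx : A v x = true) : x = a ∨ x = b ∨ x = c ∨ x = d := by
  have hb : A v b = true := sg_adj hnx h s1
  have hc : A v c = true := sg_adj hnx hb s2
  have hd : A v d = true := sg_adj hnx hc s3
  have s4 : σ v d = a := sg4 hcyc h s1 s2 s3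
  have nab : b ≠ a := sg_ne hnx h s1
  have nbc : c ≠ b := sg_ne hnx hb s2
  have ncd : d ≠ c := sg_ne hnx hc s3
  have nda : a ≠ d := sg_ne hnx hd s4
  have nac : c ≠ a := sg2_ne hcyc h s1 s2
  have nbd : d ≠ b := sg2_ne hcyc hb s2 s3
  by_cases hxa : x = a
  · exact Or.inl hxa
  by_cases hxb : x = b
  · exact Or.inr (Or.inl hxb)
  by_cases hxc : x = c
  · exact Or.inr (Or.inr (Or.inl hxc))
  by_cases hxd : x = d
  · exact Or.inr (Or.inr (Or.inr hxd))
  exfalso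
  have hsub : ({x, a, b, c, d} : Finset (Fin 12)) ⊆ Finset.univ.filter (fun j : Fin 12 => A v j = true) := by
    intro y hy
    simp only [Finset.mem_insert, Finset.mem_singleton] at hy
    simp only [Finset.mem_filter, Finset.mem_univ, true_and]
    rcases hy with rfl | rfl | rfl | rfl | rfl <;> assumption
  have hcard : ({x, a, b, c, d} : Finset (Fin 12)).card = 5 := by
    rw [Finset.card_insert_of_notMem, Finset.card_insert_of_notMem, Finset.card_insert_of_notMem,
      Finset.card_insert_of_notMem, Finset.card_singleton]
    · simp only [Finset.mem_singleton]; exact ncd.symm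
    · simp only [Finset.mem_insert, Finset.mem_singleton, not_or]; exact ⟨nbc.symm, nbd.symm⟩
    · simp only [Finset.mem_insert, Finset.mem_singleton, not_or]; exact ⟨nab.symm, nac.symm, nda⟩
    · simp only [Finset.mem_insert, Finset.mem_singleton, not_or]; exact ⟨hxa, hxb, hxc, hxd⟩
  have hle := Finset.card_le_card hsub
  rw [hcard, hdeg] at hle
  omega

/-- A vertex distinct from the four rotation entries of `v` is not adjacent to `v`. [folklore] -/
theorem rot_nadj (hdeg : ∀ i : Fin 12, (Finset.univ.filter (fun j : Fin 12 => A i j = true)).card = 4)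
    (hnx : ∀ v a : Fin 12, A v a = true → (A v (σ v a) = true ∧ σ v a ≠ a))
    (hcyc : ∀ v a : Fin 12, A v a = true → (σ v (σ v a) ≠ a ∧ σ v (σ v (σ v (σ v a))) = a))
    {v a b c d x : Fin 12} (h : A v a = true) (s1 : σ v a = b) (s2 : σ v b = c) (s3 : σ v c = d)
    (n1 : x ≠ a) (n2 : x ≠ b) (n3 : x ≠ c) (n4 : x ≠ d) : A v x = false := by
  cases hx : A v x
  · rfl
  · rcases rot_cases hdeg hnx hcyc h s1 s2 s3 hx with e | e | e | e
    exacts [(n1 e).elim, (n2 e).elim, (n3 e).elim, (n4 e).elim]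

/-! ## Exactly two small corners -/

section corners

variable (hdeg : ∀ i : Fin 12, (Finset.univ.filter (fun j : Fin 12 => A i j = true)).card = 4)
  (hnx : ∀ v a : Fin 12, A v a = true → (A v (σ v a) = true ∧ σ v a ≠ a))
  (hcyc : ∀ v a : Fin 12, A v a = true → (σ v (σ v a) ≠ a ∧ σ v (σ v (σ v (σ v a))) = a))
  (htwo : ∀ v : Fin 12, (Finset.univ.filter (fun a : Fin 12 => A v a = true ∧ A a (σ v a) = true)).card = 2)

/-- Membership in the set of small corners at `v`. [folklore] -/
theorem mem_corners {v y : Fin 12} :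
    y ∈ Finset.univ.filter (fun a : Fin 12 => A v a = true ∧ A a (σ v a) = true) ↔
      (A v y = true ∧ A y (σ v y) = true) := by
  simp only [Finset.mem_filter, Finset.mem_univ, true_and]

include htwo in
/-- Two distinct small corners are all the small corners. [folklore] -/
theorem corners_eq_pair {v p q : Fin 12} (hp : A v p = true ∧ A p (σ v p) = true)
    (hq : A v q = true ∧ A q (σ v q) = true) (hpq : p ≠ q) (y : Fin 12)
    (hy : A v y = true ∧ A y (σ v y) = true) : y = p ∨ y = q := by
  set S := Finset.univ.filter (fun a : Fin 12 => A v a = true ∧ A a (σ v a) = true) with hS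
  have hsub : ({p, q} : Finset (Fin 12)) ⊆ S := by
    intro z hz
    simp only [Finset.mem_insert, Finset.mem_singleton] at hz
    rcases hz with rfl | rfl
    · exact mem_corners.2 hp
    · exact mem_corners.2 hq
  have hle : S.card ≤ ({p, q} : Finset (Fin 12)).card := by
    rw [hS, htwo v, Finset.card_pair hpq]
  have heq := Finset.eq_of_subset_of_card_le hsub hle
  have hyS : y ∈ S := mem_corners.2 hy
  rw [← heq] at hyS
  simpa only [Finset.mem_insert, Finset.mem_singleton] using hyS

include hnx hcyc htwo in
/-- Two consecutive small corners: the other two corners are large. [folklore] -/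
theorem cTT12 {v a b c d : Fin 12} (h : A v a = true) (s1 : σ v a = b) (s2 : σ v b = c)
    (s3 : σ v c = d) (t1 : A a b = true) (t2 : A b c = true) : A c d = false ∧ A d a = false := by
  have hb : A v b = true := sg_adj hnx h s1
  have hc : A v c = true := sg_adj hnx hb s2
  have hd : A v d = true := sg_adj hnx hc s3
  have s4 : σ v d = a := sg4 hcyc h s1 s2 s3
  have hp : A v a = true ∧ A a (σ v a) = true := ⟨h, by rw [s1]; exact t1⟩
  have hq : A v b = true ∧ A b (σ v b) = true := ⟨hb, by rw [s2]; exact t2⟩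
  have key := corners_eq_pair htwo hp hq (sg_ne hnx h s1).symm
  constructor
  · cases hcd : A c d
    · rfl
    · rcases key c ⟨hc, by rw [s3]; exact hcd⟩ with e | e
      · exact (sg2_ne hcyc h s1 s2 e).elim
      · exact (sg_ne hnx hb s2 e).elim
  · cases hda : A d a
    · rfl
    · rcases key d ⟨hd, by rw [s4]; exact hda⟩ with e | e
      · exact (sg_ne hnx hd s4 e.symm).elim
      · exact (sg2_ne hcyc hb s2 s3 e).elim

include hnx hcyc htwo in
/-- Two opposite small corners: the other two corners are large. [folklore] -/
theorem cTT13 {v a b c d : Fin 12} (h : A v a = true) (s1 : σ v a = b) (s2 : σ v b = c)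
    (s3 : σ v c = d) (t1 : A a b = true) (t3 : A c d = true) : A b c = false ∧ A d a = false := by
  have hb : A v b = true := sg_adj hnx h s1
  have hc : A v c = true := sg_adj hnx hb s2
  have hd : A v d = true := sg_adj hnx hc s3
  have s4 : σ v d = a := sg4 hcyc h s1 s2 s3
  have hp : A v a = true ∧ A a (σ v a) = true := ⟨h, by rw [s1]; exact t1⟩
  have hq : A v c = true ∧ A c (σ v c) = true := ⟨hc, by rw [s3]; exact t3⟩
  have key := corners_eq_pair htwo hp hq (sg2_ne hcyc h s1 s2).symm
  constructor
  · cases hbc : A b c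
    · rfl
    · rcases key b ⟨hb, by rw [s2]; exact hbc⟩ with e | e
      · exact (sg_ne hnx h s1 e).elim
      · exact (sg_ne hnx hb s2 e.symm).elim
  · cases hda : A d a
    · rfl
    · rcases key d ⟨hd, by rw [s4]; exact hda⟩ with e | e
      · exact (sg_ne hnx hd s4 e.symm).elim
      · exact (sg_ne hnx hc s3 e).elim

include htwo in
/-- If every small corner at `v` is `p` or `q`, then both `p` and `q` are small corners (there are
exactly two). [folklore] -/
theorem corners_of_subset_pair {v p q : Fin 12}
    (hsub : ∀ y : Fin 12, (A v y = true ∧ A y (σ v y) = true) → y = p ∨ y = q) :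
    (A v p = true ∧ A p (σ v p) = true) ∧ (A v q = true ∧ A q (σ v q) = true) := by
  have hsub' : Finset.univ.filter (fun a : Fin 12 => A v a = true ∧ A a (σ v a) = true) ⊆
      ({p, q} : Finset (Fin 12)) := by
    intro y hy
    have := hsub y (mem_corners.1 hy)
    simpa only [Finset.mem_insert, Finset.mem_singleton] using this
  have hle : ({p, q} : Finset (Fin 12)).card ≤
      (Finset.univ.filter (fun a : Fin 12 => A v a = true ∧ A a (σ v a) = true)).card := by
    rw [htwo v]; exact Finset.card_le_two
  have heq := Finset.eq_of_subset_of_card_le hsub' hle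
  constructor
  · apply mem_corners.1; rw [heq]; simp
  · apply mem_corners.1; rw [heq]; simp

include hdeg hnx hcyc htwo in
/-- Two consecutive large corners: the other two corners are small. [folklore] -/
theorem cFF12 {v a b c d : Fin 12} (h : A v a = true) (s1 : σ v a = b) (s2 : σ v b = c)
    (s3 : σ v c = d) (f1 : A a b = false) (f2 : A b c = false) : A c d = true ∧ A d a = true := by
  have s4 : σ v d = a := sg4 hcyc h s1 s2 s3
  have key : ∀ y : Fin 12, (A v y = true ∧ A y (σ v y) = true) → y = c ∨ y = d := by
    intro y hy
    rcases rot_cases hdeg hnx hcyc h s1 s2 s3 hy.1 with rfl | rfl | rfl | rfl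
    · rw [s1] at hy; exact (tf hy.2 f1).elim
    · rw [s2] at hy; exact (tf hy.2 f2).elim
    · exact Or.inl rfl
    · exact Or.inr rfl
  obtain ⟨⟨-, hc⟩, ⟨-, hd⟩⟩ := corners_of_subset_pair htwo key
  rw [s3] at hc; rw [s4] at hd
  exact ⟨hc, hd⟩

include hdeg hnx hcyc htwo in
/-- Two opposite large corners: the other two corners are small. [folklore] -/
theorem cFF13 {v a b c d : Fin 12} (h : A v a = true) (s1 : σ v a = b) (s2 : σ v b = c)
    (s3 : σ v c = d) (f1 : A a b = false) (f3 : A c d = false) : A b c = true ∧ A d a = true := by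
  have s4 : σ v d = a := sg4 hcyc h s1 s2 s3
  have key : ∀ y : Fin 12, (A v y = true ∧ A y (σ v y) = true) → y = b ∨ y = d := by
    intro y hy
    rcases rot_cases hdeg hnx hcyc h s1 s2 s3 hy.1 with rfl | rfl | rfl | rfl
    · rw [s1] at hy; exact (tf hy.2 f1).elim
    · exact Or.inl rfl
    · rw [s3] at hy; exact (tf hy.2 f3).elim
    · exact Or.inr rfl
  obtain ⟨⟨-, hb⟩, ⟨-, hd⟩⟩ := corners_of_subset_pair htwo key
  rw [s2] at hb; rw [s4] at hd
  exact ⟨hb, hd⟩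

end corners

end Summit.AtomisticToContinuum.Crystallization.Theorems.ZeroDefectDensityBirth.Comb

namespace Summit.AtomisticToContinuum.Crystallization.Theorems.ZeroDefectDensityBirth

/-- **Sub-stub `stub_combRules`** (registered one-line form of `Comb.quad`): a large corner closes
into a quadrilateral whose diagonal through the corner vertex is not an edge. [folklore] -/
theorem stub_combRules : ∀ (A : Fin 12 → Fin 12 → Bool) (σ : Fin 12 → Fin 12 → Fin 12), (∀ i : Fin 12, A i i = false) → (∀ i j : Fin 12, A i j = A j i) → (∀ v a : Fin 12, A v a = true → A a (σ v a) = true → (σ a (σ v a) = v ∧ σ (σ v a) v = a)) → (∀ v a : Fin 12, A v a = true → A a (σ v a) = false → ∃ w : Fin 12, A a w = true ∧ σ a w = v ∧ A w (σ v a) = true ∧ σ (σ v a) v = w ∧ σ w (σ v a) = a) → ∀ v a b : Fin 12, A v a = true → σ v a = b → A a b = false → ∃ w : Fin 12, A a w = true ∧ σ a w = v ∧ A w b = true ∧ σ b v = w ∧ σ w b = a ∧ A v w = false := by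
  intro A σ hirr hsym htri hquad v a b h s f
  exact Comb.quad hirr hsym htri hquad h s f

end Summit.AtomisticToContinuum.Crystallization.Theorems.ZeroDefectDensityBirth
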